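import Summits.QuantumFields.BalabanUV.T4Continuum.Spine.NE3.NestedMeanSmoothInterpolant
import Summits.QuantumFields.BalabanUV.T4Continuum.Spine.NE3.SlicePoincareSlicB8Reduction
import HarnessLib

/-!
# T⁴ programme, node NE3 — census R44 (file 2∕2): THE NESTED-MEAN COMPETITOR SHAPE (CS_W) OF R43 AT A CURVED BACKGROUND, WITH `A = 0` AND A k-FREE `δ`

Cell `pub-balaban-gaps` (track G2, seat `ne3`, unit `pub-balaban-gaps-ne3-g10`; writer prover-pub-balaban-gaps-ne3-g10-0, 2026-08-25), census `ne/NE3.md` §4 R44 ∕ §16.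
WHAT.  **`competitorShape_curved`**: at every unitary `(N·L^{j+1})`-periodic background of the tower's small-field class with `(L^{j+1})²·x ≤ θ`, every skew periodic `ζ`
has a competitor `u` with `u − ζ ∈ avgKernelGauges L N (j+1) W` (the SAME nested transported block means) and
`2·ΣΣ nhs (gaugeDir W u) + 32·M²·Σ nhs (covLapSite W u) ≤ 0·ΣΣ nhs (gaugeDir W ζ) + δ·M⁻²·Σ nhs ζ`, `δ = (2 + 32δ₁)δ₁`, `δ₁ = 8·card n·d·(1 + 2(d−1)θ)²·(2·8^d)²`
— EXACTLY the displayed hypothesis (CS_W) of `SlicePoincareSlicB8Reduction.slicePoincare_slicB8_of_frameFree_of_competitor`, k-FREE.  Proof: `u :=` file 1's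
Δ_W-smooth exact nested-mean interpolant of `q := bmeanIterW ζ`, Jensen (`NE3NestedBlockMeanJensenHS`), and the arithmetic `8·card n·Φ·M^{2−d} ≤ δ₁`
(`M(M−1)x ≤ θ`, `tentMean ≥ 8^{−d}`).
CONTENT (0 sorry, no `def`; [folklore]): §3 **`competitorShape_curved`**; §4 **`slicePoincare_slicB8_of_frameFree`** (THE END's `hP` at ONE background ⇐ the owner swarm's
(P♮) on `T_♮(W)` + K6-Ξ's smallness + ONE absorption line — NO OTHER HYPOTHESIS) and **`slicePoincare_slicB8_sfClass_of_lines`**: OVER BAŁABAN's CLASS,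
`∀ j W ∈ sfClass d L N ε (j+1), SlicePoincare L (j+1) W (slicB8 L N (j+1) W) (4·card n·(69 + 2δ)·CPLine) (periodBox (N·L^{j+1}))` from the owner's four k-free lines +
`128·(69 + 2δ)·CPLine·#planes·card n·ε² ≤ 1` — THE END's LAST [B9]-§3-TYPE BINDER `hP` IS A THEOREM MODULO k-FREE NUMERIC LINES ON `ε`.  HONEST FRAMING as in file 1: nothing of Bałaban's asserted; **NE3 is NOT proved**; spine 0∕9; NOT continuum, NOT Clay.
-/

set_option autoImplicit false

open scoped BigOperators Matrix Matrix.Norms.L2Operator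
open Finset

namespace Summit.QuantumFields.BalabanUV.T4Continuum.NE3.NestedMeanCompetitorCurved

open Literature.MathematicalPhysics.QuantumFieldTheory.Balaban1983to89
open B7Prop1Explicit B7Prop2Explicit MatrixNorms
open T4AveragingDeficitWall (IsUnitaryCfg IsSkewDir SmallField Ad Plane)
open T4AveragingDeficitWallBoundary (IsPeriodicCfg periodBox mem_periodBox)
open AveragingDeficitPeriodicCounting (IsPeriodicDir)
open AveragingDeficitNearIdentity (Ad_add Ad_real_smul)
open AveragingDeficitTwoLevelPrep (prop1Radius)
open AveragingDeficitMultiLevelPrep (tower LevelSmall)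
open AveragingDeficitHSInner (nhsNormSq_smul)
open SpreadLift (loopRad)
open BlockAveragePushDirGauge (gaugeDir isPeriodicDir_gaugeDir)
open NE3CovariantCalculus (hsR nhsNormSq_sub_le nhsNormSq_neg)
open NE3CovariantWeitzenbock (covDiv)
open NE3CovariantBlockMean (bmeanIterW)
open NE3FrameFreeSliceW (bmeanIterW_add bmeanIterW_smul bmeanIterW_zero')
open NE3CurvedProjectedLandau (tower_eq_pow_mul)
open NE3NestedMeanBlockOperator (tentMean tentMean_pos inv_le_tentMean star_bmeanIterW bmeanIterW_add_period')
open NE3CompetitorNestedFix (nfixW nfixCoef bmeanIterW_nfixW nfixW_add_period sum_normSq_gaugeDir_nfixW_le)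
open NE3TopRadiusLetters (E_le_half_of_levelSmall)
open NE3NearScalarSolve (existsUnique_solve_norm)
open NE3HilbertSchmidtTorus (Sec extS resS extS_add extS_smul extS_resS extS_add_period norm_sq_resS norm_sq_eq_sum_extS resS_add)
open NE3CovariantAdjointTorus (gaugeDir_neg_conjTranspose covDiv_neg_conjTranspose)
open NE3SpectralCutTorus (cutLow cutHigh cutLow_add_period cutHigh_add_period cutLow_add_cutHigh cutHigh_add_fun cutHigh_smul_fun
  sum_nhsNormSq_cutHigh_le sum_nhsNormSq_covDiv_gaugeDir_cutLow_le sum_nhsNormSq_gaugeDir_cutLow_le)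
open NE3NestedBlockMeanJensenHS (sum_nhsNormSq_bmeanIterW_le_one)
open NE3DressedBlockField (dressW)
open NE3TentBump (bump)
open NE3.PairLandauB8 (avgKernelGauges mem_avgKernelGauges_iff covLapSite)
open NE3.LandauProjectionB8 (covDiv_gaugeDir_eq_covLapSite covLapSite_add)
open NE3.SlicB8FlatTangentRep (half_sub_ct_mem nhsNormSq_half_sub_ct_le half_sub_ct_of_skew)

open NE3.NestedMeanSmoothInterpolant (exists_smooth_nestedMean_interpolant)
open NE3CovariantLineSumsError (sq_mul_le_prop1Radius)
open NE3FrameFreeSliceW (frameFreeBlockLandauW)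
open NE3SlicePoincareShape (SlicePoincare)
open NE3SlicePoincareBudgetLine (CPLine ShLine SmallYLine)
open NE3CovariantLineSumsL2 (C2sq)
open NE3CovariantLineSumsL2Tower (rho)
open NE3ClassSlicePoincare (xi_of_line classSlicePoincare_of_lines)
open MinimalActionRate (sfClass)
open NE3.PairLandauB8Avg (slicB8)
open NE3.SlicePoincareCoulombN (CPLine_nonneg)
open NE3.SlicePoincareSlicB8Reduction (slicePoincare_slicB8_of_frameFree_of_competitor)

noncomputable section

variable {d : ℕ} {n : Type*} [Fintype n] [DecidableEq n]

/-! ## §3 The competitor shape (CS_W) of R43, with `A = 0` and a k-free `δ` -/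

set_option maxHeartbeats 800000 in
/-- **(CS_W) AT A CURVED BACKGROUND** (`1 ≤ d`, `2 ≤ L`, `1 ≤ N`; unitary `W` of period `N·L^{j+1}` in the tower's small-field class with `(L^{j+1})²·x ≤ θ`):
every skew `(N·L^{j+1})`-periodic `ζ` has a competitor `u` with `u − ζ ∈ avgKernelGauges L N (j+1) W` (same NESTED TRANSPORTED BLOCK MEANS) and
`2·ΣΣ nhs (gaugeDir W u) + 32·M²·Σ nhs (covLapSite W u) ≤ 0·ΣΣ nhs (gaugeDir W ζ) + δ·M⁻²·Σ nhs ζ`, `δ = (2 + 32δ₁)·δ₁`,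
`δ₁ = 8·card n·d·(1 + 2(d−1)θ)²·(2·8^d)²` — R43's displayed shape, k-FREE.  (`u :=` the interpolant of §2 for `q := bmeanIterW ζ`; Jensen.) [folklore] -/
theorem competitorShape_curved [Nonempty n] (hd : 1 ≤ d) {L N : ℕ} (hL : 2 ≤ L) (hN : 1 ≤ N) (j : ℕ)
    {W : Site d → Fin d → (Matrix n n ℂ)ˣ} {x θ : ℝ} (hWu : IsUnitaryCfg W) (hWP : IsPeriodicCfg W ((N * L ^ (j + 1) : ℕ) : ℤ))
    (hx : 0 ≤ x) (hsm : LevelSmall d L j x) (hWx : SmallField W x) (hθ : ((L : ℝ) ^ (j + 1)) ^ 2 * x ≤ θ)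
    (ζ : Site d → Matrix n n ℂ) (hζs : ∀ y, ζ y ∈ skewAdjoint (Matrix n n ℂ))
    (hζP : ∀ (y : Site d) (i : Fin d), ζ (y + ((N * L ^ (j + 1) : ℕ) : ℤ) • e i) = ζ y) :
    ∃ u : Site d → Matrix n n ℂ, (fun y => u y - ζ y) ∈ avgKernelGauges (d := d) (n := n) L N (j + 1) W ∧
      2 * (∑ y ∈ periodBox (d := d) (N * L ^ (j + 1)), ∑ κ : Fin d, nhsNormSq (gaugeDir W u y κ))
          + 32 * ((L : ℝ) ^ (j + 1)) ^ 2 * ∑ y ∈ periodBox (d := d) (N * L ^ (j + 1)), nhsNormSq (covLapSite W u y)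
        ≤ 0 * (∑ y ∈ periodBox (d := d) (N * L ^ (j + 1)), ∑ κ : Fin d, nhsNormSq (gaugeDir W ζ y κ))
          + ((2 + 32 * (8 * (Fintype.card n : ℝ) * d * (1 + 2 * (((d : ℝ) - 1) * θ)) ^ 2 * (2 * (8 : ℝ) ^ d) ^ 2))
              * (8 * (Fintype.card n : ℝ) * d * (1 + 2 * (((d : ℝ) - 1) * θ)) ^ 2 * (2 * (8 : ℝ) ^ d) ^ 2))
            * (((L : ℝ) ^ (j + 1)) ^ 2)⁻¹ * ∑ y ∈ periodBox (d := d) (N * L ^ (j + 1)), nhsNormSq (ζ y) := by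
  have hL1 : 1 ≤ L := by omega
  have hM1 : 1 ≤ L ^ (j + 1) := Nat.one_le_pow _ _ hL1
  have hM2 : 2 ≤ L ^ (j + 1) := le_trans hL (Nat.le_self_pow (Nat.succ_ne_zero j) L)
  have hMR : ((L ^ (j + 1) : ℕ) : ℝ) = (L : ℝ) ^ (j + 1) := by push_cast; rfl
  have hM0 : (0 : ℝ) < (L : ℝ) ^ (j + 1) := by positivity
  have hM1r : (1 : ℝ) ≤ (L : ℝ) ^ (j + 1) := by rw [← hMR]; exact_mod_cast hM1
  have hNM : N * L ^ (j + 1) = L ^ (j + 1) * N := Nat.mul_comm _ _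
  have htower : tower L N (j + 1) = L ^ (j + 1) * N := by rw [tower_eq_pow_mul]
  have hWP_T : IsPeriodicCfg W ((tower L N (j + 1) : ℕ) : ℤ) := by rw [htower, ← hNM]; exact hWP
  have ht0 : 0 < tentMean d (L ^ (j + 1)) := tentMean_pos hM2 d
  have hd1 : (1 : ℝ) ≤ d := by exact_mod_cast hd
  have hdm : (0 : ℝ) ≤ (d : ℝ) - 1 := by linarith
  have hθ0 : 0 ≤ θ := le_trans (by positivity) hθ
  -- the coarse datum
  have hζP_T : ∀ (y : Site d) (i : Fin d), ζ (y + ((tower L N (j + 1) : ℕ) : ℤ) • e i) = ζ y := by rw [htower, ← hNM]; exact hζP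
  have hqs : ∀ z, bmeanIterW L (j + 1) W ζ z ∈ skewAdjoint (Matrix n n ℂ) := by
    intro z
    rw [skewAdjoint.mem_iff, star_bmeanIterW hL1 j hWu hx hsm hWx ζ z]
    have hfun : (fun y => star (ζ y)) = (-1 : ℝ) • ζ := by
      funext y; rw [Pi.smul_apply, (skewAdjoint.mem_iff.mp (hζs y)), neg_one_smul]
    rw [hfun, bmeanIterW_smul, Pi.smul_apply, neg_one_smul]
  have hqP : ∀ (z : Site d) (i : Fin d), bmeanIterW L (j + 1) W ζ (z + (N : ℤ) • e i) = bmeanIterW L (j + 1) W ζ z :=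
    bmeanIterW_add_period' j hWP_T hζP_T
  obtain ⟨v, hvs, hvP, hvmean, hvgrad, hvlap⟩ :=
    exists_smooth_nestedMean_interpolant hd hL hN j hWu hWP hx hsm hWx hqs hqP
  -- Jensen: `M^d·Σ nhs q ≤ Σ nhs ζ`
  have hJ : ((L : ℝ) ^ (j + 1)) ^ d * ∑ z ∈ periodBox (d := d) N, nhsNormSq (bmeanIterW L (j + 1) W ζ z)
      ≤ ∑ y ∈ periodBox (d := d) (N * L ^ (j + 1)), nhsNormSq (ζ y) := by
    have h := sum_nhsNormSq_bmeanIterW_le_one hL1 j hWu hx hsm hWx ζ N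
    rw [← mul_sum, ← hNM] at h; exact h
  refine ⟨v, ?_, ?_⟩
  · refine mem_avgKernelGauges_iff.mpr ⟨fun y => (skewAdjoint _).sub_mem (hvs y) (hζs y), fun y i => by simp only [hvP y i, hζP y i], ?_⟩
    have h : (fun y => v y - ζ y) = v + (-1 : ℝ) • ζ := by funext y; simp [sub_eq_add_neg]
    rw [h, bmeanIterW_add, bmeanIterW_smul, hvmean]
    funext z; simp
  · -- the arithmetic: `γ := Cg·M^{2−d} ≤ δ₁`
    obtain ⟨S, hS⟩ : ∃ S : ℝ, S = ∑ z ∈ periodBox (d := d) N, nhsNormSq (bmeanIterW L (j + 1) W ζ z) := ⟨_, rfl⟩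
    obtain ⟨Z, hZ⟩ : ∃ Z : ℝ, Z = ∑ y ∈ periodBox (d := d) (N * L ^ (j + 1)), nhsNormSq (ζ y) := ⟨_, rfl⟩
    obtain ⟨Cg, hCg⟩ : ∃ C : ℝ, C = 8 * ((d : ℝ) * (((L ^ (j + 1) : ℕ) : ℝ)) ^ d
        * (1 / (((L ^ (j + 1) : ℕ) : ℝ)) + 2 * (((d : ℝ) - 1) * ((((L ^ (j + 1) : ℕ) : ℝ)) - 1) * x)) ^ 2
              * (2 / tentMean d (L ^ (j + 1))) ^ 2) * (Fintype.card n : ℝ) := ⟨_, rfl⟩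
    obtain ⟨δ₁, hδ₁⟩ : ∃ D : ℝ, D = 8 * (Fintype.card n : ℝ) * d * (1 + 2 * (((d : ℝ) - 1) * θ)) ^ 2 * (2 * (8 : ℝ) ^ d) ^ 2 := ⟨_, rfl⟩
    rw [← hS, ← hCg] at hvgrad hvlap
    rw [← hZ, ← hS] at hJ
    rw [← hZ, ← hδ₁]
    have hS0 : 0 ≤ S := by rw [hS]; exact sum_nonneg fun _ _ => nhsNormSq_nonneg _
    have hZ0 : 0 ≤ Z := by rw [hZ]; exact sum_nonneg fun _ _ => nhsNormSq_nonneg _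
    have hCg0 : 0 ≤ Cg := by rw [hCg]; positivity
    rw [hMR] at hvlap hCg
    -- `γ = Cg·M²∕M^d ≤ δ₁`
    obtain ⟨γ, hγdef⟩ : ∃ g : ℝ, g = Cg * ((L : ℝ) ^ (j + 1)) ^ 2 / ((L : ℝ) ^ (j + 1)) ^ d := ⟨_, rfl⟩
    have hγ0 : 0 ≤ γ := by rw [hγdef]; positivity
    have hγ : γ = 8 * (Fintype.card n : ℝ) * d * (1 + 2 * (((d : ℝ) - 1) * (((L : ℝ) ^ (j + 1) - 1) * (L : ℝ) ^ (j + 1) * x))) ^ 2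
            * (2 / tentMean d (L ^ (j + 1))) ^ 2 := by
      rw [hγdef, hCg]; field_simp
    have hγle : γ ≤ δ₁ := by
      rw [hγ, hδ₁]
      have h1 : ((L : ℝ) ^ (j + 1) - 1) * (L : ℝ) ^ (j + 1) * x ≤ θ := by
        have : ((L : ℝ) ^ (j + 1) - 1) * (L : ℝ) ^ (j + 1) * x ≤ ((L : ℝ) ^ (j + 1)) ^ 2 * x := by
          have : ((L : ℝ) ^ (j + 1) - 1) * (L : ℝ) ^ (j + 1) ≤ ((L : ℝ) ^ (j + 1)) ^ 2 := by nlinarith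
          exact mul_le_mul_of_nonneg_right this hx
        exact this.trans hθ
      have h2 : 0 ≤ 1 + 2 * (((d : ℝ) - 1) * (((L : ℝ) ^ (j + 1) - 1) * (L : ℝ) ^ (j + 1) * x)) := by
        have : 0 ≤ ((L : ℝ) ^ (j + 1) - 1) * (L : ℝ) ^ (j + 1) * x := mul_nonneg (mul_nonneg (by linarith) hM0.le) hx
        have := mul_nonneg hdm this; linarith
      have h3 : 1 + 2 * (((d : ℝ) - 1) * (((L : ℝ) ^ (j + 1) - 1) * (L : ℝ) ^ (j + 1) * x)) ≤ 1 + 2 * (((d : ℝ) - 1) * θ) := by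
        have := mul_le_mul_of_nonneg_left h1 hdm; linarith
      have h4 : 2 / tentMean d (L ^ (j + 1)) ≤ 2 * (8 : ℝ) ^ d := by
        have hinv := inv_le_tentMean hM2 d
        rw [div_le_iff₀ ht0]
        have h8 : (0 : ℝ) < (8 : ℝ) ^ d := by positivity
        calc (2 : ℝ) = 2 * (8 : ℝ) ^ d * ((8 : ℝ) ^ d)⁻¹ := by field_simp
          _ ≤ 2 * (8 : ℝ) ^ d * tentMean d (L ^ (j + 1)) := mul_le_mul_of_nonneg_left hinv (by positivity)
      have h5 : 0 ≤ 2 / tentMean d (L ^ (j + 1)) := by positivity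
      have hA : (1 + 2 * (((d : ℝ) - 1) * (((L : ℝ) ^ (j + 1) - 1) * (L : ℝ) ^ (j + 1) * x))) ^ 2 ≤ (1 + 2 * (((d : ℝ) - 1) * θ)) ^ 2 :=
        pow_le_pow_left₀ h2 h3 2
      have hB : (2 / tentMean d (L ^ (j + 1))) ^ 2 ≤ (2 * (8 : ℝ) ^ d) ^ 2 := pow_le_pow_left₀ h5 h4 2
      have hc0 : (0 : ℝ) ≤ 8 * (Fintype.card n : ℝ) * d := by positivity
      calc 8 * (Fintype.card n : ℝ) * d * (1 + 2 * (((d : ℝ) - 1) * (((L : ℝ) ^ (j + 1) - 1) * (L : ℝ) ^ (j + 1) * x))) ^ 2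
              * (2 / tentMean d (L ^ (j + 1))) ^ 2
          ≤ 8 * (Fintype.card n : ℝ) * d * (1 + 2 * (((d : ℝ) - 1) * θ)) ^ 2 * (2 / tentMean d (L ^ (j + 1))) ^ 2 := by
            exact mul_le_mul_of_nonneg_right (mul_le_mul_of_nonneg_left hA hc0) (by positivity)
        _ ≤ 8 * (Fintype.card n : ℝ) * d * (1 + 2 * (((d : ℝ) - 1) * θ)) ^ 2 * (2 * (8 : ℝ) ^ d) ^ 2 :=
            mul_le_mul_of_nonneg_left hB (by positivity)
    have hδ₁0 : 0 ≤ δ₁ := hγ0.trans hγle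
    -- assemble: `2·grad + 32M²·lap ≤ (2 + 32γ)·γ·M⁻²·Z ≤ (2 + 32δ₁)·δ₁·M⁻²·Z`
    obtain ⟨Wz, hWz⟩ : ∃ w : ℝ, w = (((L : ℝ) ^ (j + 1)) ^ 2)⁻¹ * Z := ⟨_, rfl⟩
    have hW0 : 0 ≤ Wz := by rw [hWz]; positivity
    have hCS : Cg * S ≤ γ * Wz := by
      have hSZ : S ≤ (((L : ℝ) ^ (j + 1)) ^ d)⁻¹ * Z := by
        rw [inv_mul_eq_div, le_div_iff₀ (by positivity), mul_comm]; exact hJ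
      have := mul_le_mul_of_nonneg_left hSZ hCg0
      calc Cg * S ≤ Cg * ((((L : ℝ) ^ (j + 1)) ^ d)⁻¹ * Z) := this
        _ = γ * Wz := by rw [hγdef, hWz]; field_simp
    have hlapγ : 32 * ((L : ℝ) ^ (j + 1)) ^ 2 * (Cg / ((L : ℝ) ^ (j + 1)) ^ d * (Cg * S)) = 32 * γ * (Cg * S) := by
      rw [hγdef]; ring
    have h32 : 32 * γ * (Cg * S) ≤ 32 * γ * (γ * Wz) := mul_le_mul_of_nonneg_left hCS (by positivity)
    have hsq : γ * γ ≤ δ₁ * δ₁ := mul_le_mul hγle hγle hγ0 hδ₁0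
    have hfin : (2 + 32 * γ) * γ * Wz ≤ (2 + 32 * δ₁) * δ₁ * Wz := by
      have : (2 + 32 * γ) * γ ≤ (2 + 32 * δ₁) * δ₁ := by nlinarith [hsq, hγle]
      exact mul_le_mul_of_nonneg_right this hW0
    rw [zero_mul, zero_add, mul_assoc ((2 + 32 * δ₁) * δ₁), ← hWz]
    have hM32 : (0 : ℝ) ≤ 32 * ((L : ℝ) ^ (j + 1)) ^ 2 := by positivity
    have hlap2 := mul_le_mul_of_nonneg_left hvlap hM32
    rw [hlapγ] at hlap2
    nlinarith [hvgrad, hlap2, hCS, h32, hfin, hW0, hγ0]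

/-! ## §4 THE END's binder `hP` at a curved background: (P♮) on `slicB8` from the owner swarm's theorem, modulo lines -/

/-- **(P♮) ON B8's SLICE `slicB8(W)` AT ONE CURVED BACKGROUND OF THE CLASS — FROM THE OWNER SWARM's (P♮) ON `T_♮(W)` ALONE** (`1 ≤ d`, `2 ≤ L`, `1 ≤ N`; unitary
`W` of period `N·L^{j+1}`, `0 ≤ x`, `LevelSmall d L j x`, `SmallField W x`, `(L^{j+1})²x ≤ θ`, K6-Ξ's `hsmall`; `δ = (2 + 32δ₁)δ₁`, `δ₁ = 8·card n·d·(1 + 2(d−1)θ)²·(2·8^d)²`):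
(P♮) on `frameFreeBlockLandauW L N (j+1) W` with constant `C ≥ 0` ∧ `128·(69 + 2δ)·C·#planes·card n·((L^{j+1})²x)² ≤ 1` ⟹
`SlicePoincare L (j+1) W (slicB8 L N (j+1) W) (4·card n·(69 + 2δ)·C) (periodBox (N·L^{j+1}))` — R43 with (CS_W) := §3 (`A = 0`, `t = 1`). [folklore] -/
theorem slicePoincare_slicB8_of_frameFree [Nonempty n] (hd : 1 ≤ d) {L N : ℕ} (hL : 2 ≤ L) (hN : 1 ≤ N) (j : ℕ)
    {W : Site d → Fin d → (Matrix n n ℂ)ˣ} {x θ : ℝ} (hWu : IsUnitaryCfg W) (hWP : IsPeriodicCfg W ((N * L ^ (j + 1) : ℕ) : ℤ))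
    (hx : 0 ≤ x) (hs : LevelSmall d L j x) (hWx : SmallField W x) (hθ : ((L : ℝ) ^ (j + 1)) ^ 2 * x ≤ θ)
    (hsmall : 8 * d * (((L : ℝ) ^ (j + 1)) * (((d : ℝ) - 1) * (((L : ℝ) ^ (j + 1)) - 1) * x)) ^ 2
      + 2 * (Fintype.card n * (4 * (d : ℝ) ^ 2 * ((L : ℝ) ^ (j + 1) - 1) ^ 2 * x + 16 * d * loopRad d L ((prop1Radius d L)^[j] x)) ^ 2)
        ≤ 1 / 2)
    {C : ℝ} (hC : 0 ≤ C)
    (hP : SlicePoincare L (j + 1) W (frameFreeBlockLandauW (d := d) (n := n) L N (j + 1) W) C (periodBox (d := d) (N * L ^ (j + 1))))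
    (habs : 128 * (69 + 2 * ((2 + 32 * (8 * (Fintype.card n : ℝ) * d * (1 + 2 * (((d : ℝ) - 1) * θ)) ^ 2 * (2 * (8 : ℝ) ^ d) ^ 2))
              * (8 * (Fintype.card n : ℝ) * d * (1 + 2 * (((d : ℝ) - 1) * θ)) ^ 2 * (2 * (8 : ℝ) ^ d) ^ 2)))
        * C * (Fintype.card (Plane d) : ℝ) * (Fintype.card n : ℝ) * (((L : ℝ) ^ (j + 1)) ^ 2 * x) ^ 2 ≤ 1) :
    SlicePoincare L (j + 1) W (slicB8 (d := d) (n := n) L N (j + 1) W)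
      (4 * (Fintype.card n : ℝ) * (69 + 2 * ((2 + 32 * (8 * (Fintype.card n : ℝ) * d * (1 + 2 * (((d : ℝ) - 1) * θ)) ^ 2 * (2 * (8 : ℝ) ^ d) ^ 2))
              * (8 * (Fintype.card n : ℝ) * d * (1 + 2 * (((d : ℝ) - 1) * θ)) ^ 2 * (2 * (8 : ℝ) ^ d) ^ 2))) * C)
      (periodBox (d := d) (N * L ^ (j + 1))) := by
  set δW : ℝ := (2 + 32 * (8 * (Fintype.card n : ℝ) * d * (1 + 2 * (((d : ℝ) - 1) * θ)) ^ 2 * (2 * (8 : ℝ) ^ d) ^ 2))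
      * (8 * (Fintype.card n : ℝ) * d * (1 + 2 * (((d : ℝ) - 1) * θ)) ^ 2 * (2 * (8 : ℝ) ^ d) ^ 2) with hδW
  have hθ0 : 0 ≤ θ := le_trans (by positivity) hθ
  have hd1 : (1 : ℝ) ≤ d := by exact_mod_cast hd
  have hdm : (0 : ℝ) ≤ (d : ℝ) - 1 := by linarith
  have hδW0 : 0 ≤ δW := by
    rw [hδW]
    have : 0 ≤ 1 + 2 * (((d : ℝ) - 1) * θ) := by have := mul_nonneg hdm hθ0; linarith
    positivity
  have hCS := competitorShape_curved hd hL hN j hWu hWP hx hs hWx hθ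
  have hR := slicePoincare_slicB8_of_frameFree_of_competitor hd hL hN j hWu hWP hx hs hWx hsmall hC hP (A := 0) (δ := δW) (t := 1)
    le_rfl hδW0 one_pos (fun ζ hζs hζP => hCS ζ hζs hζP) ?_
  · have e : (5 : ℝ) + 64 * 1 + 2 * (0 + δW / 1) = 69 + 2 * δW := by ring
    rw [e] at hR
    exact hR
  · have e : (5 : ℝ) + 64 * 1 + 2 * (0 + δW / 1) = 69 + 2 * δW := by ring
    rw [e]
    exact habs

/-- **THE END's LAST [B9]-§3-TYPE BINDER `hP` OVER BAŁABAN's CLASS, MODULO k-FREE NUMERIC LINES** (`3 ≤ d`, `2 ≤ L`, `1 ≤ N`; class radius `0 < ε ≤ θ`, K1 cut `0 < εc`,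
row Y9's family, the owner's four lines of `NE3ClassSlicePoincare.classSlicePoincare_of_lines`, and the absorption line `128·(69 + 2δ)·CPLine·#planes·card n·ε² ≤ 1`):
`∀ j W, W ∈ sfClass d L N ε (j+1) → SlicePoincare L (j+1) W (slicB8 L N (j+1) W) (4·card n·(69 + 2δ)·CPLine d L (card n) εc θ) (periodBox (N·L^{j+1}))` —
(P♮) on B8's slice at EVERY background of the class, k-FREE, N-dependent only through nothing: the owner swarm's curved theorem on `T_♮(W)` ∘ R42 ∘ R43 ∘ R44.
[folklore] -/
theorem slicePoincare_slicB8_sfClass_of_lines [Nonempty n] (hd : 3 ≤ d) {L N : ℕ} (hL : 2 ≤ L) (hN : 1 ≤ N) {ε θ εc : ℝ}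
    (hε : 0 < ε) (hεθ : ε ≤ θ) (hεc : 0 < εc)
    (hsmall : ∀ j : ℕ, LevelSmall d L (j + 1) (ε / ((L : ℝ) ^ (j + 2)) ^ 2))
    (h1 : ShLine d L (Fintype.card n) εc θ ≤ 1 / 2) (h2 : SmallYLine d L (Fintype.card n) εc θ ≤ 1 / 2)
    (h3 : 68 / 3 * (((d : ℝ) + 1) * ((d : ℝ) + 4)) * C2sq d L * θ ≤ rho d L / 2)
    (h4 : 8 * d * (((d : ℝ) - 1) * θ) ^ 2
      + 2 * ((Fintype.card n : ℝ) * ((4 * (d : ℝ) ^ 2 + 272 * d * (((d : ℝ) + 1) * ((d : ℝ) + 4))) * θ) ^ 2) ≤ 1 / 2)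
    (h6 : 128 * (69 + 2 * ((2 + 32 * (8 * (Fintype.card n : ℝ) * d * (1 + 2 * (((d : ℝ) - 1) * θ)) ^ 2 * (2 * (8 : ℝ) ^ d) ^ 2))
              * (8 * (Fintype.card n : ℝ) * d * (1 + 2 * (((d : ℝ) - 1) * θ)) ^ 2 * (2 * (8 : ℝ) ^ d) ^ 2)))
        * CPLine d L (Fintype.card n) εc θ * (Fintype.card (Plane d) : ℝ) * (Fintype.card n : ℝ) * ε ^ 2 ≤ 1) :
    ∀ j : ℕ, ∀ W : Site d → Fin d → (Matrix n n ℂ)ˣ, W ∈ sfClass d L N ε (j + 1) →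
      SlicePoincare L (j + 1) W (slicB8 (d := d) (n := n) L N (j + 1) W)
        (4 * (Fintype.card n : ℝ) * (69 + 2 * ((2 + 32 * (8 * (Fintype.card n : ℝ) * d * (1 + 2 * (((d : ℝ) - 1) * θ)) ^ 2 * (2 * (8 : ℝ) ^ d) ^ 2))
              * (8 * (Fintype.card n : ℝ) * d * (1 + 2 * (((d : ℝ) - 1) * θ)) ^ 2 * (2 * (8 : ℝ) ^ d) ^ 2))) * CPLine d L (Fintype.card n) εc θ)
        (periodBox (d := d) (N * L ^ (j + 1))) := by
  intro j W hW
  have hPcls := classSlicePoincare_of_lines (n := n) hd hL hN hε hεθ hεc hsmall h1 h2 h3 h4 j W hW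
  obtain ⟨hWu, hWP, hWx⟩ := hW
  have hd1 : 1 ≤ d := by omega
  have hL0 : (0 : ℝ) < L := by exact_mod_cast (show 0 < L by omega)
  have hx : 0 ≤ ε / ((L : ℝ) ^ (j + 1)) ^ 2 := by positivity
  have hMx : ((L : ℝ) ^ (j + 1)) ^ 2 * (ε / ((L : ℝ) ^ (j + 1)) ^ 2) = ε := by field_simp
  have hθ' : ((L : ℝ) ^ (j + 1)) ^ 2 * (ε / ((L : ℝ) ^ (j + 1)) ^ 2) ≤ θ := by rw [hMx]; exact hεθ
  have hs : LevelSmall d L j (ε / ((L : ℝ) ^ (j + 1)) ^ 2) := by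
    have hy : 0 ≤ ε / ((L : ℝ) ^ (j + 2)) ^ 2 := by positivity
    have hxy : ε / ((L : ℝ) ^ (j + 1)) ^ 2 ≤ prop1Radius d L (ε / ((L : ℝ) ^ (j + 2)) ^ 2) := by
      have e : ε / ((L : ℝ) ^ (j + 1)) ^ 2 = (L : ℝ) ^ 2 * (ε / ((L : ℝ) ^ (j + 2)) ^ 2) := by
        field_simp; ring
      rw [e]; exact sq_mul_le_prop1Radius (d := d) L _
    exact AveragingDeficitMultiLevelPrep.LevelSmall.mono (d := d) hx hxy (hsmall j).2
  have hxi := xi_of_line (c := Fintype.card n) hd1 hL j hx hs hθ' h4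
  have hCP0 : 0 ≤ CPLine d L (Fintype.card n) εc θ := CPLine_nonneg hd1 L (by positivity) hεc.le (hε.le.trans hεθ)
  have habs : 128 * (69 + 2 * ((2 + 32 * (8 * (Fintype.card n : ℝ) * d * (1 + 2 * (((d : ℝ) - 1) * θ)) ^ 2 * (2 * (8 : ℝ) ^ d) ^ 2))
              * (8 * (Fintype.card n : ℝ) * d * (1 + 2 * (((d : ℝ) - 1) * θ)) ^ 2 * (2 * (8 : ℝ) ^ d) ^ 2)))
        * CPLine d L (Fintype.card n) εc θ * (Fintype.card (Plane d) : ℝ) * (Fintype.card n : ℝ)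
        * (((L : ℝ) ^ (j + 1)) ^ 2 * (ε / ((L : ℝ) ^ (j + 1)) ^ 2)) ^ 2 ≤ 1 := by rw [hMx]; exact h6
  exact slicePoincare_slicB8_of_frameFree hd1 hL hN j hWu hWP hx hs hWx hθ' hxi hCP0 hPcls habs

end

end Summit.QuantumFields.BalabanUV.T4Continuum.NE3.NestedMeanCompetitorCurved
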